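import Summits.CriticalPhenomena.PercolationContinuityZ3.Theorems.PercNearOneGluingNoHeavyRsw3SetToSetHardCrossingChain
import Summits.CriticalPhenomena.PercolationContinuityZ3.Theorems.PercAnnulusCrossingBoxCrossingDefs
import Literature.Probability.Percolation.RSWProofs
import HarnessLib

/-!
# RSW3 lane (P2, gen 16): the column geometry for "(A2)□ ⇒ hard crossings" — patches of the bottom face by pigeonhole, and the
# last exit through the bottom face (every `p`, `ℤ³`)

builds on p205010 (kernel theorem, internal audit signed; external expert review pending) — NOT used in this file.

Cell `prim-rsw3`, prover seat `prim-rsw3-p2` (gen 16), memo `run/shared/lean/prim/rsw3/P2-RSWLITE.md` §23.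
Support file (`--supports stmt-CriticalPhenomena-4575`); no definitions, no named facts, no sorries.

Two deterministic/elementary pieces of the engine `…Rsw3SetToSetHardCrossingEngine` (Basu–Sapozhnikov's (A2)□ ⇒ Kesten's hard
crossings), kept apart from the chain of `…Rsw3SetToSetHardCrossingChain`:
* `exists_le_real_openCrossing_patch` — the block `{0..h} × {0..ℓ}²`, `ℓ = (w+1)(t+1) - 1`, being crossed from its top face to its bottom
  face (`boxCross ![h, ℓ, ℓ] 0`, rewritten as an `openCrossing` event by `boxCross_eq_openCrossing_top_bot`), one of the `(t+1)²` patches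
  `{0} × [(w+1)a, (w+1)a+w] × [(w+1)b, (w+1)b+w]` of the bottom face receives the crossing with probability `≥ P_p(boxCross ![h,ℓ,ℓ] 0)/(t+1)²`
  (union bound + pigeonhole; every `p`);
* `mem_boxCross_of_mem_openConnIn_column` — in the column `[z, N] × [0, W]²`, an open path from `{x₀ ≤ 0}` to the top face `{x₀ = N}` contains,
  after its last exit from `{x₀ ≤ 0}`, a hard crossing of `{0..N} × {0..W}²` (lattice configurations; the tree's `PathIn.last_exit`);
plus coordinate bookkeeping in `ℤ³` (`mem_Icc_vec3_iff`, `mem_ball_vec3_iff`) and `setToSetQuasiMultAspectAt_of_le` (the constant of (A2)□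
may be lowered).

References: H. Kesten, *Percolation Theory for Mathematicians* (1982), §3.3 Def. 1–3 and Comment (v) [Kesten1982]; D. Basu,
A. Sapozhnikov, Electron. Commun. Probab. 22 (2017) no. 26, §1 (A2) [BasuSapozhnikov2017ECP]; G. Grimmett, *Percolation* (1999), §11.7
[GrimmettPercolation1999]. [folklore]
-/

noncomputable section

namespace Summit.CriticalPhenomena.PercolationContinuityZ3.Theorems

namespace Rsw3

open MeasureTheory Literature.Probability.LatticeModels Literature.Probability.Percolation
open SurfaceTension Crossing SimpleGraph

/-! ## Coordinates in `ℤ³` -/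

/-- Membership in a block `Icc lo hi` of `ℤ³`, coordinatewise. [folklore] -/
theorem mem_Icc_vec3_iff {lo hi x : Site 3} :
    x ∈ Finset.Icc lo hi ↔ (lo 0 ≤ x 0 ∧ x 0 ≤ hi 0) ∧ (lo 1 ≤ x 1 ∧ x 1 ≤ hi 1) ∧ (lo 2 ≤ x 2 ∧ x 2 ≤ hi 2) := by
  rw [Finset.mem_Icc, Pi.le_def, Pi.le_def, Fin.forall_fin_succ, Fin.forall_fin_two, Fin.forall_fin_succ,
    Fin.forall_fin_two]
  simp only [Fin.succ_zero_eq_one, Fin.succ_one_eq_two]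
  tauto

/-- Membership in a ball `Λ_c(r)` of `ℤ³` with centre `c = (c₀, c₁, c₂)`, coordinatewise. [folklore] -/
theorem mem_ball_vec3_iff {c₀ c₁ c₂ : ℤ} {r : ℕ} {v : Site 3} :
    v ∈ GM.ball (![c₀, c₁, c₂] : Site 3) r ↔
      (-(r : ℤ) ≤ v 0 - c₀ ∧ v 0 - c₀ ≤ r) ∧ (-(r : ℤ) ≤ v 1 - c₁ ∧ v 1 - c₁ ≤ r) ∧ (-(r : ℤ) ≤ v 2 - c₂ ∧ v 2 - c₂ ≤ r) := by
  rw [GM.mem_ball, Fin.forall_fin_succ, Fin.forall_fin_two]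
  simp only [Fin.succ_zero_eq_one, Fin.succ_one_eq_two, Matrix.cons_val_zero, Matrix.cons_val_one, Matrix.head_cons,
    Matrix.cons_val_two, Matrix.tail_cons]

/-! ## Kesten's block crossing as an open crossing event; patches of the bottom face -/

/-- `boxCross M i` is the open crossing event inside the block from its top face `{x_i = M_i}` to its bottom face `{x_i = 0}`.
[cite: Kesten1982, §3.3 Def. 1–3] -/
theorem boxCross_eq_openCrossing_top_bot {d : ℕ} (M : Site d) (i : Fin d) :
    boxCross M i = openCrossing (↑(Finset.Icc (0 : Site d) M) : Set (Site d))
      {y | y ∈ Finset.Icc (0 : Site d) M ∧ y i = M i} {x | x ∈ Finset.Icc (0 : Site d) M ∧ x i = 0} := by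
  rw [openCrossing_comm]
  ext ω
  simp only [boxCross, Set.mem_setOf_eq, mem_openCrossing_iff]
  constructor
  · rintro ⟨x, hx, y, hy, hx0, hyM, h⟩
    exact ⟨x, ⟨hx, hx0⟩, y, ⟨hy, hyM⟩, h⟩
  · rintro ⟨x, ⟨hx, hx0⟩, y, ⟨hy, hyM⟩, h⟩
    exact ⟨x, hx, y, hy, hx0, hyM, h⟩

/-- Open crossing events distribute over finite unions of the target. [folklore] -/
theorem openCrossing_biUnion_right {V ι : Type*} (S A : Set V) (I : Finset ι) (B : ι → Set V) :
    openCrossing S A (⋃ i ∈ I, B i) = ⋃ i ∈ I, openCrossing S A (B i) := by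
  ext ω
  simp only [mem_openCrossing_iff, Set.mem_iUnion, exists_prop]
  constructor
  · rintro ⟨x, hx, y, ⟨i, hi, hy⟩, h⟩
    exact ⟨i, hi, x, hx, y, hy, h⟩
  · rintro ⟨i, hi, x, hx, y, hy, h⟩
    exact ⟨x, hx, y, ⟨i, hi, hy⟩, h⟩

/-- **Pigeonhole over the `(t+1)²` patches of the bottom face** (every `p`, every `w`, `t`; side `ℓ = (w+1)(t+1) - 1`): the block
`{0..h} × {0..ℓ}²` being crossed from top to bottom, some patch `{0} × [(w+1)a, (w+1)a + w] × [(w+1)b, (w+1)b + w]` (`a, b ≤ t`) receives the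
crossing with probability `≥ P_p(boxCross ![h, ℓ, ℓ] 0) / (t+1)²`. [folklore] -/
theorem exists_le_real_openCrossing_patch (p : unitInterval) (h w t : ℕ) :
    ∃ a b : ℕ, a ≤ t ∧ b ≤ t ∧
      (bondPercolation (zdGraph 3) p).real (boxCross ![(h : ℤ), ((w + 1) * (t + 1) - 1 : ℕ), ((w + 1) * (t + 1) - 1 : ℕ)] 0) /
          ((t : ℝ) + 1) ^ 2 ≤
        (bondPercolation (zdGraph 3) p).real
          (openCrossing (↑(Finset.Icc (0 : Site 3) ![(h : ℤ), ((w + 1) * (t + 1) - 1 : ℕ), ((w + 1) * (t + 1) - 1 : ℕ)]) : Set (Site 3))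
            {y | y ∈ Finset.Icc (0 : Site 3) ![(h : ℤ), ((w + 1) * (t + 1) - 1 : ℕ), ((w + 1) * (t + 1) - 1 : ℕ)] ∧ y 0 = h}
            {x | x ∈ Finset.Icc (0 : Site 3) ![(h : ℤ), ((w + 1) * (t + 1) - 1 : ℕ), ((w + 1) * (t + 1) - 1 : ℕ)] ∧ x 0 = 0 ∧
              ((w : ℤ) + 1) * a ≤ x 1 ∧ x 1 ≤ ((w : ℤ) + 1) * a + w ∧
              ((w : ℤ) + 1) * b ≤ x 2 ∧ x 2 ≤ ((w : ℤ) + 1) * b + w}) := by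
  classical
  set M : Site 3 := ![(h : ℤ), ((w + 1) * (t + 1) - 1 : ℕ), ((w + 1) * (t + 1) - 1 : ℕ)] with hM
  set S : Set (Site 3) := ↑(Finset.Icc (0 : Site 3) M) with hS
  set Top : Set (Site 3) := {y | y ∈ Finset.Icc (0 : Site 3) M ∧ y 0 = h} with hTop
  set Pt : ℕ × ℕ → Set (Site 3) := fun ab => {x | x ∈ Finset.Icc (0 : Site 3) M ∧ x 0 = 0 ∧
      ((w : ℤ) + 1) * ab.1 ≤ x 1 ∧ x 1 ≤ ((w : ℤ) + 1) * ab.1 + w ∧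
      ((w : ℤ) + 1) * ab.2 ≤ x 2 ∧ x 2 ≤ ((w : ℤ) + 1) * ab.2 + w} with hPt
  set I : Finset (ℕ × ℕ) := Finset.range (t + 1) ×ˢ Finset.range (t + 1) with hI
  set μ := bondPercolation (zdGraph 3) p with hμ
  have hℓ : (((w + 1) * (t + 1) - 1 : ℕ) : ℤ) = ((w : ℤ) + 1) * (t + 1) - 1 := by
    have : 1 ≤ (w + 1) * (t + 1) := Nat.one_le_iff_ne_zero.2 (by positivity)
    push_cast [Nat.cast_sub this]; ring
  -- the bottom face is covered by the patches
  have hcover : {x : Site 3 | x ∈ Finset.Icc (0 : Site 3) M ∧ x 0 = 0} ⊆ ⋃ ab ∈ I, Pt ab := by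
    intro x hx
    obtain ⟨hxI, hx0⟩ := hx
    have hxI' := hxI
    rw [mem_Icc_vec3_iff] at hxI'
    simp only [hM, Pi.zero_apply, Matrix.cons_val_zero, Matrix.cons_val_one, Matrix.head_cons, Matrix.cons_val_two,
      Matrix.tail_cons] at hxI'
    obtain ⟨-, ⟨h1, h1'⟩, ⟨h2, h2'⟩⟩ := hxI'
    rw [hℓ] at h1' h2'
    have hw1 : (0 : ℤ) < (w : ℤ) + 1 := by positivity
    -- patch indices
    set a : ℤ := x 1 / ((w : ℤ) + 1) with ha
    set b : ℤ := x 2 / ((w : ℤ) + 1) with hb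
    have ha0 : 0 ≤ a := Int.ediv_nonneg h1 hw1.le
    have hb0 : 0 ≤ b := Int.ediv_nonneg h2 hw1.le
    have ha1 : ((w : ℤ) + 1) * a ≤ x 1 := Int.mul_ediv_self_le (ne_of_gt hw1)
    have hb1 : ((w : ℤ) + 1) * b ≤ x 2 := Int.mul_ediv_self_le (ne_of_gt hw1)
    have ha2 : x 1 < ((w : ℤ) + 1) * a + ((w : ℤ) + 1) := Int.lt_mul_ediv_self_add hw1
    have hb2 : x 2 < ((w : ℤ) + 1) * b + ((w : ℤ) + 1) := Int.lt_mul_ediv_self_add hw1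
    have hat : a ≤ t := by
      by_contra hat
      have hta : (t : ℤ) + 1 ≤ a := by omega
      have := mul_le_mul_of_nonneg_left hta hw1.le
      linarith
    have hbt : b ≤ t := by
      by_contra hbt
      have htb : (t : ℤ) + 1 ≤ b := by omega
      have := mul_le_mul_of_nonneg_left htb hw1.le
      linarith
    simp only [Set.mem_iUnion, exists_prop]
    refine ⟨(a.toNat, b.toNat), ?_, ?_⟩
    · rw [hI, Finset.mem_product, Finset.mem_range, Finset.mem_range]
      constructor <;> omega
    · simp only [hPt, Set.mem_setOf_eq, Int.toNat_of_nonneg ha0, Int.toNat_of_nonneg hb0]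
      exact ⟨hxI, hx0, ha1, by linarith, hb1, by linarith⟩
  -- union bound
  have hunion : μ.real (boxCross M 0) ≤ ∑ ab ∈ I, μ.real (openCrossing S Top (Pt ab)) := by
    rw [boxCross_eq_openCrossing_top_bot]
    calc μ.real (openCrossing S Top {x : Site 3 | x ∈ Finset.Icc (0 : Site 3) M ∧ x 0 = 0})
        ≤ μ.real (openCrossing S Top (⋃ ab ∈ I, Pt ab)) :=
          measureReal_mono (openCrossing_mono le_rfl le_rfl hcover) (measure_ne_top _ _)
      _ = μ.real (⋃ ab ∈ I, openCrossing S Top (Pt ab)) := by rw [openCrossing_biUnion_right]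
      _ ≤ ∑ ab ∈ I, μ.real (openCrossing S Top (Pt ab)) := measureReal_biUnion_finset_le _ _
  -- pigeonhole
  have hcard : (I.card : ℝ) = ((t : ℝ) + 1) ^ 2 := by
    rw [hI, Finset.card_product, Finset.card_range]; push_cast; ring
  have hIne : I.Nonempty := ⟨(0, 0), by simp [hI]⟩
  obtain ⟨ab, hab, hle⟩ := Finset.exists_le_of_sum_le hIne (f := fun _ => μ.real (boxCross M 0) / ((t : ℝ) + 1) ^ 2)
    (g := fun ab => μ.real (openCrossing S Top (Pt ab))) (by
      rw [Finset.sum_const, nsmul_eq_mul, hcard, mul_div_cancel₀ _ (by positivity)]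
      exact hunion)
  rw [hI, Finset.mem_product, Finset.mem_range, Finset.mem_range] at hab
  exact ⟨ab.1, ab.2, by omega, by omega, hle⟩

/-! ## The bottom of the column: a connection from below the bottom face to the top face is a hard crossing -/

/-- **Last exit through the bottom face** (lattice configurations).  In the column `Z = [z, N] × [0, W]²`, if a vertex `x` with `x₀ ≤ 0` is
joined inside `Z` to a vertex `y` of the top face `{y₀ = N}` (`N ≥ 1`), then the block `{0..N} × {0..W}²` is crossed in direction `0`:
the last edge of the path leaving `{x₀ ≤ 0}` starts on the bottom face. [cite: Kesten1982, §3.3 Comment (v)] -/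
theorem mem_boxCross_of_mem_openConnIn_column {z : ℤ} {N W : ℕ} (hN : 1 ≤ N) {x y : Site 3}
    (hx : x 0 ≤ 0) (hy : y ∈ Finset.Icc (![z, 0, 0] : Site 3) ![(N : ℤ), W, W]) (hy0 : y 0 = N)
    {ω : BondConfig (Site 3)} (hω : ω ⊆ (zdGraph 3).edgeSet)
    (hxy : ω ∈ openConnIn (↑(Finset.Icc (![z, 0, 0] : Site 3) ![(N : ℤ), W, W]) : Set (Site 3)) x y) :
    ω ∈ boxCross (![(N : ℤ), W, W] : Site 3) 0 := by
  have hpath := DCT16.pathIn_of_mem_openConnIn hxy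
  have hN' : (0 : ℤ) < N := by exact_mod_cast hN
  have hyC : y ∉ {v : Site 3 | v 0 ≤ 0} := by
    simp only [Set.mem_setOf_eq, not_le, hy0]; exact hN'
  obtain ⟨a, b, haC, haZ, hbC, hadj, hby⟩ := hpath.last_exit (C := {v : Site 3 | v 0 ≤ 0}) hx hyC
  simp only [Set.mem_setOf_eq, not_le] at haC hbC
  have hab0 := DCT16.abs_sub_le_one_of_adj (DCT16.adj_of_openGraph_adj hω hadj) 0
  rw [abs_le] at hab0
  have ha0 : a 0 = 0 := by linarith [hab0.1, hab0.2]
  rw [Finset.mem_coe, mem_Icc_vec3_iff] at haZ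
  simp only [Matrix.cons_val_zero, Matrix.cons_val_one, Matrix.head_cons, Matrix.cons_val_two, Matrix.tail_cons] at haZ
  -- the box `Q = {0..N} × {0..W}²`
  have hQ : ∀ v : Site 3, v ∈ (↑(Finset.Icc (![z, 0, 0] : Site 3) ![(N : ℤ), W, W]) : Set (Site 3)) → 0 < v 0 →
      v ∈ (↑(Finset.Icc (0 : Site 3) ![(N : ℤ), W, W]) : Set (Site 3)) := by
    intro v hv hv0
    rw [Finset.mem_coe, mem_Icc_vec3_iff] at hv ⊢
    simp only [Matrix.cons_val_zero, Matrix.cons_val_one, Matrix.head_cons, Matrix.cons_val_two, Matrix.tail_cons,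
      Pi.zero_apply] at hv ⊢
    exact ⟨⟨hv0.le, hv.1.2⟩, hv.2.1, hv.2.2⟩
  have haQ : a ∈ (↑(Finset.Icc (0 : Site 3) ![(N : ℤ), W, W]) : Set (Site 3)) := by
    rw [Finset.mem_coe, mem_Icc_vec3_iff]
    simp only [Matrix.cons_val_zero, Matrix.cons_val_one, Matrix.head_cons, Matrix.cons_val_two, Matrix.tail_cons,
      Pi.zero_apply]
    exact ⟨⟨ha0.ge, by rw [ha0]; exact hN'.le⟩, haZ.2.1, haZ.2.2⟩
  have hbQ : b ∈ (↑(Finset.Icc (0 : Site 3) ![(N : ℤ), W, W]) : Set (Site 3)) := hQ b hby.left_mem.1 hbC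
  have hby' : PathIn (openGraph ω) (↑(Finset.Icc (0 : Site 3) ![(N : ℤ), W, W]) : Set (Site 3)) b y := by
    refine hby.mono fun v hv => hQ v hv.1 ?_
    have h2 : v ∉ {u : Site 3 | u 0 ≤ 0} := hv.2
    simp only [Set.mem_setOf_eq, not_le] at h2
    exact h2
  have hay : PathIn (openGraph ω) (↑(Finset.Icc (0 : Site 3) ![(N : ℤ), W, W]) : Set (Site 3)) a y :=
    (PathIn.of_adj haQ hbQ hadj).trans hby'
  have hyQ : y ∈ (↑(Finset.Icc (0 : Site 3) ![(N : ℤ), W, W]) : Set (Site 3)) :=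
    hQ y (Finset.mem_coe.2 hy) (by rw [hy0]; exact hN')
  refine ⟨a, Finset.mem_coe.1 haQ, y, Finset.mem_coe.1 hyQ, ha0, ?_, DCT16.mem_openConnIn_of_pathIn hay⟩
  simp only [Matrix.cons_val_zero, hy0]

end Rsw3

end Summit.CriticalPhenomena.PercolationContinuityZ3.Theorems
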